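import Mathlib
import Summits.BirchSwinnertonDyer.BirchSwinnertonDyer.Theorems.ResidualThetaTransportAtTwoSignedMuSeedAtTwoPlusNonsquareDescentEngine
import Summits.BirchSwinnertonDyer.BirchSwinnertonDyer.Theorems.ResidualThetaTransportAtTwoSignedMuSeedAtTwoPlusNonsquareDescentMuCriterion
import HarnessLib

/-!
# Non-square descent — THE ONE-LEVEL CERTIFICATE, COMPOSED (stub S3 of the line card `nonsquare-descent`, module form of
# «`μ(Q') = 0 ⟺ ∃ m GNS(m)`») for the seed crux `SignedMuSeedAtTwoPlus` stmt-BirchSwinnertonDyer-21438 (parent Kμ⁺ `SignedMuVanishingAtTwoPlus`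
# stmt-BirchSwinnertonDyer-20689, route ResidualThetaTransportAtTwo)

Cell `bsd-wall`, width seat `bsd-wall-rtt-p4-w2` g17 (`--supports`, closes nothing).  THEOREMS ONLY; BSD is not proved by this; nothing
arithmetic is asserted.  This file COMPOSES the squares-dichotomy engine (`Theorems/…NonsquareDescentEngine.lean`) with the rank-one torsion
criterion (`Theorems/…NonsquareDescentMuCriterion.lean`) into the statement of stub S3 `squaresDichotomyArith` of
`Cruxes/SignedMuSeedAtTwoPlus/Lines/nonsquare-descent.md` at the module level:

Data (dictionary in brackets): a field `k` (`𝔽₄ = 𝒪/2`); a tower `W n` of `k⟦X⟧`-modules (`𝓔_n^χ/2`) with injective `ι n : W n → W (n+1)`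
(inclusion; injective by the odd-valuation Kummer step, `Theorems/…NonsquareDescentSquareClasses.lean`) and `N n : W (n+1) → W n` (norm) with
`ι n (N n v) = X^{d n} • v` for an unbounded ladder `d` (`d n = 2ⁿ`: `N ≡ T^{2ⁿ} mod 2`, `Theorems/…NonsquareDescentTowerNorms.lean`); a
norm-coherent family `u n ∈ W n` (`ū_n`, Robert's distribution relation); a module `Winf` (`V_∞ = Ē^χ/2`) with projections `π n : Winf → W n`
that jointly detect `0` and an element `uinf` (`ū_∞`) with `π n uinf = u n`.

* `eq_zero_or_nonTorsion_of_proj` — **the `Λ`-adic dichotomy «`ū_∞` is either `0` or free»**: `uinf = 0 ∨ ∀ f ≠ 0, f • uinf ≠ 0`.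
* `isTorsion_quotient_of_proj_ne_zero` — **ONE level certifies**: if `Winf` has rank `≤ 1` (any two elements dependent: `rank_{Λ'} Ē^χ = 1`)
  and `u m ≠ 0` for ONE `m` (GNS(m)), then `Winf ⧸ ⟨uinf⟩` (`= Q'/2`) is torsion («`μ(Q') = 0`»).
* `exists_nonTorsion_quotient_of_forall_proj_eq_zero` — conversely, if `u m = 0` for EVERY `m` (`¬GNS` at all levels) and `Winf` has a
  non-torsion element, then `Winf ⧸ ⟨uinf⟩` is not torsion («`u_∞ ∈ 2Ē`, `μ(Q') ≥ 1`»).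
* `isTorsion_quotient_iff_exists_proj_ne_zero` — **`Q'/2` torsion ⟺ ∃ m, ū_m ≠ 0** (the card's «`μ(Q') = 0 ⟺ ∃ m GNS(m)`», module form).

[folklore]
-/

set_option autoImplicit false
-- the Theorems namespace of this sub repeats the summit name by design (D-0017 nested layout)
set_option linter.dupNamespace false

namespace Summit.BirchSwinnertonDyer.BirchSwinnertonDyer.Theorems.SignedMuAtTwo.NonsquareDescent

section Certificate

variable {k : Type*} [Field k]
variable (W : ℕ → Type*) [∀ n, AddCommGroup (W n)] [∀ n, Module (PowerSeries k) (W n)]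

/-- **«`ū_∞` is either `0` or free».**  For a norm-coherent family in a squares-dichotomy tower over `k⟦X⟧` and an element `uinf` of a
module projecting onto it (projections jointly detecting `0`): `uinf = 0`, or no non-zero power series kills `uinf`. [folklore] -/
theorem eq_zero_or_nonTorsion_of_proj
    (d : ℕ → ℕ) (hd : ∀ a, ∃ n, a ≤ d n)
    (ι : ∀ n, W n →ₗ[PowerSeries k] W (n + 1)) (hι : ∀ n, Function.Injective (ι n))
    (N : ∀ n, W (n + 1) →ₗ[PowerSeries k] W n)
    (hN : ∀ n (v : W (n + 1)), ι n (N n v) = (PowerSeries.X : PowerSeries k) ^ (d n) • v)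
    (u : ∀ n, W n) (hu : ∀ n, N n (u (n + 1)) = u n)
    {Winf : Type*} [AddCommGroup Winf] [Module (PowerSeries k) Winf] (π : ∀ n, Winf →ₗ[PowerSeries k] W n)
    (hsep : ∀ q : Winf, (∀ n, π n q = 0) → q = 0)
    (uinf : Winf) (hπ : ∀ n, π n uinf = u n) :
    uinf = 0 ∨ ∀ f : PowerSeries k, f ≠ 0 → f • uinf ≠ 0 := by
  by_cases h : ∀ n, u n = 0
  · exact Or.inl (eq_zero_of_forall_proj_eq_zero W π hsep u uinf hπ h)
  · push Not at h
    obtain ⟨m, hm⟩ := h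
    exact Or.inr fun f hf =>
      smul_ne_zero_of_proj_ne_zero_powerSeries W d hd ι hι N hN u hu π uinf hπ hm hf

/-- **ONE non-square level certifies `μ(Q') = 0` (module form).**  If moreover `Winf` has rank `≤ 1` and `u m ≠ 0` for ONE `m`, then every
class of `Winf ⧸ ⟨uinf⟩` is killed by a non-zero power series. [folklore] -/
theorem isTorsion_quotient_of_proj_ne_zero
    (d : ℕ → ℕ) (hd : ∀ a, ∃ n, a ≤ d n)
    (ι : ∀ n, W n →ₗ[PowerSeries k] W (n + 1)) (hι : ∀ n, Function.Injective (ι n))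
    (N : ∀ n, W (n + 1) →ₗ[PowerSeries k] W n)
    (hN : ∀ n (v : W (n + 1)), ι n (N n v) = (PowerSeries.X : PowerSeries k) ^ (d n) • v)
    (u : ∀ n, W n) (hu : ∀ n, N n (u (n + 1)) = u n)
    {Winf : Type*} [AddCommGroup Winf] [Module (PowerSeries k) Winf] (π : ∀ n, Winf →ₗ[PowerSeries k] W n)
    (uinf : Winf) (hπ : ∀ n, π n uinf = u n)
    (hrank : ∀ v w : Winf, ∃ a b : PowerSeries k, (a ≠ 0 ∨ b ≠ 0) ∧ a • v + b • w = 0)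
    {m : ℕ} (hm : u m ≠ 0) (q : Winf ⧸ Submodule.span (PowerSeries k) {uinf}) :
    ∃ b : PowerSeries k, b ≠ 0 ∧ b • q = 0 :=
  isTorsion_quotient_span_of_nonTorsion hrank
    (fun _ hf => smul_ne_zero_of_proj_ne_zero_powerSeries W d hd ι hι N hN u hu π uinf hπ hm hf) q

/-- **No non-square level ⇒ `μ(Q') ≥ 1` (module form).**  If `u m = 0` for every `m`, the projections jointly detect `0`, and `Winf` has a
non-torsion element `w`, then `Winf ⧸ ⟨uinf⟩` has a class killed by no non-zero power series. [folklore] -/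
theorem exists_nonTorsion_quotient_of_forall_proj_eq_zero
    (u : ∀ n, W n)
    {Winf : Type*} [AddCommGroup Winf] [Module (PowerSeries k) Winf] (π : ∀ n, Winf →ₗ[PowerSeries k] W n)
    (hsep : ∀ q : Winf, (∀ n, π n q = 0) → q = 0)
    (uinf : Winf) (hπ : ∀ n, π n uinf = u n) (hzero : ∀ n, u n = 0)
    {w : Winf} (hw : ∀ b : PowerSeries k, b ≠ 0 → b • w ≠ 0) :
    ∀ b : PowerSeries k, b ≠ 0 →
      b • (Submodule.Quotient.mk w : Winf ⧸ Submodule.span (PowerSeries k) {uinf}) ≠ 0 := by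
  have h0 : uinf = 0 := eq_zero_of_forall_proj_eq_zero W π hsep u uinf hπ hzero
  exact exists_nonTorsion_quotient_of_torsion (a := (1 : PowerSeries k)) one_ne_zero
    (by rw [h0, smul_zero]) hw

/-- **`μ(Q') = 0 ⟺ ∃ m, GNS(m)` (module form).**  Under the squares-dichotomy tower hypotheses, with `Winf` of rank `≤ 1` containing a
non-torsion element and projections jointly detecting `0`: `Winf ⧸ ⟨uinf⟩` is torsion iff `u m ≠ 0` for some `m`. [folklore] -/
theorem isTorsion_quotient_iff_exists_proj_ne_zero
    (d : ℕ → ℕ) (hd : ∀ a, ∃ n, a ≤ d n)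
    (ι : ∀ n, W n →ₗ[PowerSeries k] W (n + 1)) (hι : ∀ n, Function.Injective (ι n))
    (N : ∀ n, W (n + 1) →ₗ[PowerSeries k] W n)
    (hN : ∀ n (v : W (n + 1)), ι n (N n v) = (PowerSeries.X : PowerSeries k) ^ (d n) • v)
    (u : ∀ n, W n) (hu : ∀ n, N n (u (n + 1)) = u n)
    {Winf : Type*} [AddCommGroup Winf] [Module (PowerSeries k) Winf] (π : ∀ n, Winf →ₗ[PowerSeries k] W n)
    (hsep : ∀ q : Winf, (∀ n, π n q = 0) → q = 0)
    (uinf : Winf) (hπ : ∀ n, π n uinf = u n)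
    (hrank : ∀ v w : Winf, ∃ a b : PowerSeries k, (a ≠ 0 ∨ b ≠ 0) ∧ a • v + b • w = 0)
    {w : Winf} (hw : ∀ b : PowerSeries k, b ≠ 0 → b • w ≠ 0) :
    (∀ q : Winf ⧸ Submodule.span (PowerSeries k) {uinf}, ∃ b : PowerSeries k, b ≠ 0 ∧ b • q = 0)
      ↔ ∃ m, u m ≠ 0 := by
  constructor
  · intro h
    by_contra hall
    push Not at hall
    obtain ⟨b, hb, hbq⟩ := h (Submodule.Quotient.mk w)
    exact exists_nonTorsion_quotient_of_forall_proj_eq_zero W u π hsep uinf hπ hall hw b hb hbq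
  · rintro ⟨m, hm⟩
    exact isTorsion_quotient_of_proj_ne_zero W d hd ι hι N hN u hu π uinf hπ hrank hm

end Certificate

end Summit.BirchSwinnertonDyer.BirchSwinnertonDyer.Theorems.SignedMuAtTwo.NonsquareDescent
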